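import Summits.HodgeConjecture.HodgeConjecture.Theorems.HeckePrymWeilWeilTwelvefoldsSqrtMinus7HodgeModelFacts
import Summits.HodgeConjecture.HodgeConjecture.Theorems.HeckePrymWeilHyperbolicEightfoldsSqrtMinus7EndAdditiveH1
import Literature.AlgebraicGeometry.HodgeTheory.HodgeTypeConjugation
import Literature.AlgebraicGeometry.HodgeTheory.DiagonalSymmetryStability
import Literature.AlgebraicTopology.SingularHomology.CupProductProofs
import HarnessLib

/-!
# Crux `WeilTwelvefoldsSqrtMinus7` (stmt-HodgeConjecture-1261), line `amnesic-secant-sheaves-split-fourteenfolds` — lemmas for stub `stub_cmSurfaceDescentPair` (T_B, r5), part I: the curve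

Helper file of the stub `stub_cmSurfaceDescentPair` (the CM Weil surface `E × E`, `ψ = (φ, -φ)`, and its
descent pair from a degree-one model of a complex elliptic curve `(E, φ)`, `φ ≫ φ = -7`; B. van Geemen,
LNM 1594 (1994), Lemma 5.2 / 5.3; C. Schoen, Compositio 114 (1998), §10), on the tree's real carriers
`complexBetti E.X 1 = H¹(E(ℂ); ℂ)`:

* functoriality bookkeeping for homomorphisms of abelian varieties; `f ↦ f^* v` is ADDITIVE in the
  homomorphism for `v ∈ H¹` (`cm_map_add/zsmul/neg/sub`: degree-one classes are primitive — the tree's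
  `complexBetti_map_hom_mul_deg_one`);
* `cm_F_F`, `cm_eigen`, `cm_eigen_unique`: `φ^* φ^* = -7` on `H¹`, the eigenvectors `φ^* w ± s w`
  (`s² = -7`) and their uniqueness in a basis `(φ^* w, w)`;
* `cm_cup_self`, `cm_cup_comm`, `cm_cup_conj`: graded commutativity in degree `(1,1)`;
* `cm_hodgeTypes_of_eigen`: **the two `φ^*`-stable Hodge pieces `H^{1,0}`, `H^{0,1}` of a Hodge model of
  the curve are the two eigenlines of `φ^*`** (stability `HodgeModel.pullback_map_mem_hodgePQ_of_endomorphism`,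
  Hodge decomposition `isInternal_hodgePQ`, bijectivity of the pull-back to the model, Hodge symmetry
  `HodgeModel.isHodgeSymmetric`, reality of rational classes `IsRationalClass.conjClass_eq`).

Everything is proved; no named fact is taken.
-/

noncomputable section

set_option linter.dupNamespace false

open CategoryTheory Complex
open Literature.AlgebraicGeometry Literature.AlgebraicGeometry.Motives
  Literature.AlgebraicGeometry.HodgeTheory Literature.AlgebraicTopology.SingularHomology

namespace Summit.HodgeConjecture.HodgeConjecture.Theorems.WeilTwelvefoldsSqrtMinus7.AmnesicSecantSheaves

/-! ## Functoriality bookkeeping on `H•(–(ℂ); ℂ)` for homomorphisms of abelian varieties -/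

section Functoriality

variable {S T U : AbelianVariety ℂ}

/-- `(g ≫ f)^* = g^* ∘ f^*`. [cite: HatcherAT2002, §3.1 p. 201] -/
theorem cm_map_comp (g : S ⟶ T) (f : T ⟶ U) (k : ℕ) (c : complexBetti U.X k) :
    complexBetti.map (g ≫ f).hom.hom.hom k c =
      complexBetti.map g.hom.hom.hom k (complexBetti.map f.hom.hom.hom k c) := by
  rw [← CategoryTheory.comp_apply, ← complexBetti.map_comp]; rfl

/-- `𝟙^* = id`. [cite: HatcherAT2002, §3.1 p. 201] -/
theorem cm_map_id (k : ℕ) (c : complexBetti T.X k) :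
    complexBetti.map (𝟙 T : T ⟶ T).hom.hom.hom k c = c := by
  change complexBetti.map (𝟙 T.X) k c = c
  rw [complexBetti.map_id]
  rfl

/-- `f^*(a ⌣ b) = f^* a ⌣ f^* b`. [cite: HatcherAT2002, Prop. 3.10] -/
theorem cm_map_cup (f : S ⟶ T) {p q n : ℕ} (h : p + q = n) (a : complexBetti T.X p)
    (b : complexBetti T.X q) :
    complexBetti.map f.hom.hom.hom n (cupProduct h a b) =
      cupProduct h (complexBetti.map f.hom.hom.hom p a) (complexBetti.map f.hom.hom.hom q b) :=
  cupProduct_map _ _ _ _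

open scoped MonObj in
/-- **`f ↦ f^* v` is additive on `Hom(T, U)` for `v ∈ H¹(U(ℂ); ℂ)`** (degree-one classes are
primitive; `(f + g)(ℂ) = f(ℂ) · g(ℂ)` and `complexBetti_map_hom_mul_deg_one`).
[cite: LangeBirkenhake1992, Ch. 1 §1 (1.1.2) p. 10 and Lemma 1.1.17 (a)] [cite: MumfordAV1970, §1] -/
theorem cm_map_add (f g : T ⟶ U) (v : complexBetti U.X 1) :
    complexBetti.map (f + g).hom.hom.hom 1 v =
      complexBetti.map f.hom.hom.hom 1 v + complexBetti.map g.hom.hom.hom 1 v := by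
  change complexBetti.map (f.hom.hom.hom * g.hom.hom.hom) 1 v = _
  exact HyperbolicEightfoldsSqrtMinus7.DicyclicQuaternionSwitch.complexBetti_map_hom_mul_deg_one U _ _ v

/-- `(n • f)^* v = n • f^* v` on `H¹` (`f ↦ f^* v` is a homomorphism of abelian groups).
[cite: LangeBirkenhake1992, Ch. 1 §1 (1.1.2) p. 10] -/
theorem cm_map_zsmul (n : ℤ) (f : T ⟶ U) (v : complexBetti U.X 1) :
    complexBetti.map (n • f).hom.hom.hom 1 v = n • complexBetti.map f.hom.hom.hom 1 v := by
  let Λ : (T ⟶ U) →+ complexBetti T.X 1 :=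
    AddMonoidHom.mk' (fun f ↦ complexBetti.map f.hom.hom.hom 1 v) fun f g ↦ cm_map_add f g v
  exact map_zsmul Λ n f

/-- `(-f)^* v = -f^* v` on `H¹`. [cite: LangeBirkenhake1992, Ch. 1 §1 (1.1.2) p. 10] -/
theorem cm_map_neg (f : T ⟶ U) (v : complexBetti U.X 1) :
    complexBetti.map (-f).hom.hom.hom 1 v = -complexBetti.map f.hom.hom.hom 1 v := by
  let Λ : (T ⟶ U) →+ complexBetti T.X 1 :=
    AddMonoidHom.mk' (fun f ↦ complexBetti.map f.hom.hom.hom 1 v) fun f g ↦ cm_map_add f g v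
  exact map_neg Λ f

/-- `(f - g)^* v = f^* v - g^* v` on `H¹`. [cite: LangeBirkenhake1992, Ch. 1 §1 (1.1.2) p. 10] -/
theorem cm_map_sub (f g : T ⟶ U) (v : complexBetti U.X 1) :
    complexBetti.map (f - g).hom.hom.hom 1 v =
      complexBetti.map f.hom.hom.hom 1 v - complexBetti.map g.hom.hom.hom 1 v := by
  let Λ : (T ⟶ U) →+ complexBetti T.X 1 :=
    AddMonoidHom.mk' (fun f ↦ complexBetti.map f.hom.hom.hom 1 v) fun f g ↦ cm_map_add f g v
  exact map_sub Λ f g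

end Functoriality

/-! ## The curve: `φ^*` on `H¹(E(ℂ); ℂ)` -/

section Curve

variable {E : AbelianVariety ℂ} {φ : E ⟶ E}

/-- `φ^* φ^* = -7` on `H¹(E(ℂ); ℂ)` for `φ ≫ φ = -7`. [cite: vanGeemen1994HodgeAV, Lemma 5.3] -/
theorem cm_F_F (hφ : φ ≫ φ = -((7 : ℤ) • 𝟙 E)) (v : complexBetti E.X 1) :
    complexBetti.map φ.hom.hom.hom 1 (complexBetti.map φ.hom.hom.hom 1 v) = (-7 : ℂ) • v := by
  rw [← cm_map_comp, hφ, cm_map_neg, cm_map_zsmul, cm_map_id, ← Int.cast_smul_eq_zsmul ℂ, Int.cast_ofNat,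
    neg_smul]

/-- **The eigenvectors of `φ^*`**: `φ^*(φ^* w + t·w) = t·(φ^* w + t·w)` for `t² = -7`.
[cite: vanGeemen1994HodgeAV, Lemma 5.3] -/
theorem cm_eigen (hφ : φ ≫ φ = -((7 : ℤ) • 𝟙 E)) (w : complexBetti E.X 1) {t : ℂ}
    (ht : t * t = -7) :
    complexBetti.map φ.hom.hom.hom 1 (complexBetti.map φ.hom.hom.hom 1 w + t • w) =
      t • (complexBetti.map φ.hom.hom.hom 1 w + t • w) := by
  rw [map_add, map_smul, cm_F_F hφ, smul_add, smul_smul, ht]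
  abel

/-- Linear algebra: if `F w = u`, `F u = -7 w` and `(u, w)` is a basis, every `t`-eigenvector of
`F` is a multiple of `u + t·w`. [folklore] -/
theorem cm_eigen_unique {V : Type*} [AddCommGroup V] [Module ℂ V] (F : V →ₗ[ℂ] V) {u w : V}
    (hFw : F w = u) (hFu : F u = (-7 : ℂ) • w)
    (hind : ∀ p q : ℂ, p • u + q • w = 0 → p = 0 ∧ q = 0) (hsp : ∀ v, ∃ p q : ℂ, v = p • u + q • w)
    {t : ℂ} {v : V} (hv : F v = t • v) : ∃ r : ℂ, v = r • (u + t • w) := by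
  obtain ⟨p, q, rfl⟩ := hsp v
  refine ⟨p, ?_⟩
  have hF : F (p • u + q • w) = p • ((-7 : ℂ) • w) + q • u := by
    rw [map_add, map_smul, map_smul, hFu, hFw]
  have key : (q - t * p) • u + (-7 * p - t * q) • w = 0 := by
    have e : (q - t * p) • u + (-7 * p - t * q) • w =
        (p • ((-7 : ℂ) • w) + q • u) - t • (p • u + q • w) := by module
    rw [e, ← hF, hv, sub_self]
  obtain ⟨h1, -⟩ := hind _ _ key
  rw [sub_eq_zero.1 h1]
  module

/-- `v ⌣ v = 0` in `H²` for `v ∈ H¹` (graded commutativity, characteristic `0`).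
[cite: HatcherAT2002, Thm. 3.11] -/
theorem cm_cup_self (v : complexBetti E.X 1) : cupProduct (rfl : 1 + 1 = 2) v v = 0 := by
  have h := cupProduct_gradedComm_holds ℂ (ComplexPoints E.X) (rfl : 1 + 1 = 2) (rfl : 1 + 1 = 2) v v
  rw [mul_one, pow_one, neg_one_smul] at h
  have h2 : (2 : ℂ) • cupProduct (rfl : 1 + 1 = 2) v v = 0 := by
    rw [two_smul]
    nth_rewrite 1 [h]
    exact neg_add_cancel _
  exact (smul_eq_zero.1 h2).resolve_left two_ne_zero

/-- `w ⌣ u = -(u ⌣ w)` for `u, w ∈ H¹`. [cite: HatcherAT2002, Thm. 3.11] -/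
theorem cm_cup_comm (u w : complexBetti E.X 1) :
    cupProduct (rfl : 1 + 1 = 2) w u = -cupProduct (rfl : 1 + 1 = 2) u w := by
  have h := cupProduct_gradedComm_holds ℂ (ComplexPoints E.X) (rfl : 1 + 1 = 2) (rfl : 1 + 1 = 2) w u
  rwa [mul_one, pow_one, neg_one_smul] at h

/-- `(u + t·w) ⌣ (u - t·w) = -2t · (u ⌣ w)`. [cite: vanGeemen1994HodgeAV, Lemma 5.2] -/
theorem cm_cup_conj (u w : complexBetti E.X 1) (t : ℂ) :
    cupProduct (rfl : 1 + 1 = 2) (u + t • w) (u + (-t) • w) =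
      (-(2 * t)) • cupProduct (rfl : 1 + 1 = 2) u w := by
  simp only [map_add, map_smul, LinearMap.add_apply, LinearMap.smul_apply, cm_cup_self]
  rw [cm_cup_comm u w]
  module

open Literature.NumberTheory.Transcendental in
/-- **The two `φ^*`-stable Hodge pieces of `H¹` of the curve are the two eigenlines.** Let `E` be a
smooth projective curve with a `ℂ`-endomorphism `φ` such that `F = φ^*` on `V = H¹(E(ℂ); ℂ)`
satisfies `F² = s²`, `s ≠ 0`, with the `s`- (resp. `-s`-) eigenvectors all proportional to `v₊`
(resp. `v₋`), `v± ≠ 0`, and let `x₀ ≠ 0` be a rational class in `V`. Then `v₊` is of Hodge type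
`(1,0)` and `v₋` of type `(0,1)`, or the other way round. Proof: for a Hodge model `A` of `E`, the
pieces `L^{p,q} = (A^*)⁻¹ H^{p,q}`, `(p,q) ∈ {(1,0),(0,1)}`, are `F`-stable
(`pullback_map_mem_hodgePQ_of_endomorphism`), complementary (`isInternal_hodgePQ`, `A^*` bijective)
and exchanged by conjugation (`isHodgeSymmetric`), which fixes `x₀`; so neither is zero, and a
non-zero `F`-stable subspace contains `v₊` or `v₋` (`F l ± s l` are eigenvectors).
[cite: VoisinHodgeI2002, §6.1.3 Cor. 6.12 and §7.3.2] -/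
theorem cm_hodgeTypes_of_eigen {E : AbelianVariety ℂ} {φ : E ⟶ E} (hE : IsSmoothProjective 1 E.X)
    {s : ℂ} (hs : s ≠ 0)
    (hFF : ∀ v : complexBetti E.X 1, complexBetti.map φ.hom.hom.hom 1 (complexBetti.map φ.hom.hom.hom 1 v) =
      (s * s) • v)
    {vp vm x₀ : complexBetti E.X 1} (hvp : vp ≠ 0) (hvm : vm ≠ 0)
    (hEp : ∀ v : complexBetti E.X 1, complexBetti.map φ.hom.hom.hom 1 v = s • v → ∃ r : ℂ, v = r • vp)
    (hEm : ∀ v : complexBetti E.X 1, complexBetti.map φ.hom.hom.hom 1 v = (-s) • v → ∃ r : ℂ, v = r • vm)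
    (hx₀ : IsRationalClass x₀) (hx₀0 : x₀ ≠ 0) :
    (IsOfHodgeType 1 E.X 1 1 0 vp ∧ IsOfHodgeType 1 E.X 1 0 1 vm) ∨
      (IsOfHodgeType 1 E.X 1 0 1 vp ∧ IsOfHodgeType 1 E.X 1 1 0 vm) := by
  obtain ⟨A⟩ := nonempty_hodgeModel_all_holds 1 E.X hE
  set F : complexBetti E.X 1 →ₗ[ℂ] complexBetti E.X 1 := (complexBetti.map φ.hom.hom.hom 1).hom with hFdef
  have hFapp : ∀ v, F v = complexBetti.map φ.hom.hom.hom 1 v := fun _ ↦ rfl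
  -- the pieces `L p q = (A^*)⁻¹ H^{p,q}`
  set L : ℕ → ℕ → Submodule ℂ (complexBetti E.X 1) := fun p q ↦ (A.hodgePQ 1 p q).comap (A.pullback 1).hom
    with hLdef
  have hL : ∀ {p q : ℕ} {c : complexBetti E.X 1}, c ∈ L p q ↔ A.pullback 1 c ∈ A.hodgePQ 1 p q :=
    Iff.rfl
  have htype : ∀ {p q : ℕ} {c : complexBetti E.X 1}, c ∈ L p q → IsOfHodgeType 1 E.X 1 p q c :=
    fun h ↦ ⟨A, hL.1 h⟩
  -- `F`-stability
  have hstab : ∀ (p q : ℕ), ∀ c ∈ L p q, F c ∈ L p q := fun p q c h ↦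
    hL.2 (A.pullback_map_mem_hodgePQ_of_endomorphism hE φ.hom.hom.hom (hL.1 h))
  -- disjointness
  have hdisj : ∀ c : complexBetti E.X 1, c ∈ L 1 0 → c ∈ L 0 1 → c = 0 := by
    intro c h10 h01
    obtain ⟨y, hy, hyc⟩ := Submodule.mem_map.1 (hL.1 h10)
    obtain ⟨y', hy', hyc'⟩ := Submodule.mem_map.1 (hL.1 h01)
    have hyy' : y = y' := (A.deRham A.carrier 1).injective (hyc.trans hyc'.symm)
    have hd := (A.isInternal_hodgePQ 1).submodule_iSupIndep.pairwiseDisjoint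
      (show (⟨(1, 0), Finset.HasAntidiagonal.mem_antidiagonal.2 rfl⟩ :
          ↥(Finset.HasAntidiagonal.antidiagonal 1)) ≠ ⟨(0, 1), Finset.HasAntidiagonal.mem_antidiagonal.2 rfl⟩ from
        fun e ↦ absurd (congrArg (fun pq ↦ pq.1.1) e) (by norm_num))
    rw [Function.onFun, Submodule.disjoint_def] at hd
    have hy0 : y = 0 := hd y hy (hyy' ▸ hy')
    apply A.pullback_injective 1
    rw [map_zero, ← hyc, hy0, map_zero]
  -- decomposition
  have hdec : ∀ c : complexBetti E.X 1, ∃ l l', l ∈ L 1 0 ∧ l' ∈ L 0 1 ∧ c = l + l' := by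
    intro c
    set e := A.deRham A.carrier 1 with he
    have htop : e.symm (A.pullback 1 c) ∈
        ⨆ pq : ↥(Finset.HasAntidiagonal.antidiagonal 1), hodgePQ A.model A.carrier 1 pq.1.1 pq.1.2 := by
      rw [(A.isInternal_hodgePQ 1).submodule_iSup_eq_top]; trivial
    have hle : (⨆ pq : ↥(Finset.HasAntidiagonal.antidiagonal 1), hodgePQ A.model A.carrier 1 pq.1.1 pq.1.2) ≤
        hodgePQ A.model A.carrier 1 1 0 ⊔ hodgePQ A.model A.carrier 1 0 1 := by
      refine iSup_le fun pq ↦ ?_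
      obtain ⟨⟨a, b⟩, hab⟩ := pq
      have hab' : a + b = 1 := Finset.HasAntidiagonal.mem_antidiagonal.mp hab
      rcases Nat.eq_zero_or_pos a with rfl | ha
      · obtain rfl : b = 1 := by omega
        exact le_sup_right
      · obtain rfl : a = 1 := by omega
        obtain rfl : b = 0 := by omega
        exact le_sup_left
    obtain ⟨y, hy, y', hy', hyy'⟩ := Submodule.mem_sup.1 (hle htop)
    obtain ⟨l, hl⟩ := A.pullback_surjective 1 (e y)
    obtain ⟨l', hl'⟩ := A.pullback_surjective 1 (e y')
    refine ⟨l, l', ?_, ?_, ?_⟩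
    · rw [hL, hl]; exact Submodule.mem_map_of_mem hy
    · rw [hL, hl']; exact Submodule.mem_map_of_mem hy'
    · apply A.pullback_injective 1
      rw [map_add, hl, hl', ← map_add e, hyy', LinearEquiv.apply_symm_apply]
  -- conjugation exchanges the pieces and fixes `x₀`
  have hconj : ∀ {p q : ℕ} {c : complexBetti E.X 1}, c ∈ L p q →
      conjClass (ComplexPoints E.X) 1 c ∈ L q p := fun {p q c} h ↦ by
    rw [hL, A.pullback_conjClass]
    exact A.isHodgeSymmetric hE 1 p q _ (hL.1 h)
  have hx10 : x₀ ∉ L 1 0 := fun h ↦ by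
    have h' := hconj h
    rw [hx₀.conjClass_eq] at h'
    exact hx₀0 (hdisj _ h h')
  have hx01 : x₀ ∉ L 0 1 := fun h ↦ by
    have h' := hconj h
    rw [hx₀.conjClass_eq] at h'
    exact hx₀0 (hdisj _ h' h)
  obtain ⟨l, l', hl, hl', hx⟩ := hdec x₀
  have hl0 : l ≠ 0 := by
    rintro rfl
    rw [zero_add] at hx
    exact hx01 (hx ▸ hl')
  have hl'0 : l' ≠ 0 := by
    rintro rfl
    rw [add_zero] at hx
    exact hx10 (hx ▸ hl)
  -- a non-zero `F`-stable subspace contains `v₊` or `v₋`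
  have key : ∀ W : Submodule ℂ (complexBetti E.X 1), (∀ c ∈ W, F c ∈ W) →
      ∀ l ∈ W, l ≠ 0 → vp ∈ W ∨ vm ∈ W := by
    intro W hW l hl hl0
    have hp : F l + s • l ∈ W := W.add_mem (hW _ hl) (W.smul_mem _ hl)
    have hm : F l - s • l ∈ W := W.sub_mem (hW _ hl) (W.smul_mem _ hl)
    have hEp' : F (F l + s • l) = s • (F l + s • l) := by
      rw [map_add, map_smul, hFapp, hFapp, hFF]
      module
    have hEm' : F (F l - s • l) = (-s) • (F l - s • l) := by
      rw [map_sub, map_smul, hFapp, hFapp, hFF]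
      module
    by_cases h0 : F l + s • l = 0
    · have hne : F l - s • l ≠ 0 := by
        intro h1
        have h2 : (2 * s) • l = 0 := by
          have e : (2 * s) • l = (F l + s • l) - (F l - s • l) := by module
          rw [e, h0, h1, sub_zero]
        exact hl0 ((smul_eq_zero.1 h2).resolve_left (mul_ne_zero two_ne_zero hs))
      obtain ⟨r, hr⟩ := hEm _ hEm'
      have hr0 : r ≠ 0 := by
        rintro rfl
        rw [zero_smul] at hr
        exact hne hr
      refine Or.inr ?_
      have e : vm = r⁻¹ • (F l - s • l) := by rw [hr, smul_smul, inv_mul_cancel₀ hr0, one_smul]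
      rw [e]
      exact W.smul_mem _ hm
    · obtain ⟨r, hr⟩ := hEp _ hEp'
      have hr0 : r ≠ 0 := by
        rintro rfl
        rw [zero_smul] at hr
        exact h0 hr
      refine Or.inl ?_
      have e : vp = r⁻¹ • (F l + s • l) := by rw [hr, smul_smul, inv_mul_cancel₀ hr0, one_smul]
      rw [e]
      exact W.smul_mem _ hp
  rcases key (L 1 0) (hstab 1 0) l hl hl0 with h1 | h1 <;>
    rcases key (L 0 1) (hstab 0 1) l' hl' hl'0 with h2 | h2
  · exact absurd (hdisj _ h1 h2) hvp
  · exact Or.inl ⟨htype h1, htype h2⟩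
  · exact Or.inr ⟨htype h2, htype h1⟩
  · exact absurd (hdisj _ h1 h2) hvm

end Curve

end Summit.HodgeConjecture.HodgeConjecture.Theorems.WeilTwelvefoldsSqrtMinus7.AmnesicSecantSheaves

end
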